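import Literature.Topology.FourManifolds.ClosedModelCharts
import Literature.Topology.FourManifolds.CollarTheorem
import Literature.AlgebraicTopology.SingularHomology.ExcisionTheorem
import Literature.AlgebraicTopology.SingularHomology.LocalDegreeSign
import Literature.AlgebraicTopology.SingularHomology.DeformationRetractPairs
import Literature.AlgebraicTopology.SingularHomology.TripleSequence
import HarnessLib

/-!
# Homology of the closed model `W ∪ cone(∂W)`: cone neighbourhoods and `Hⱼ(W, ∂W) ≅ Hⱼ(Ŵ, ∞)`

For a null-cobordism `M = ∂W` (`Literature.Topology.FourManifolds.NullCobordism`, `W = c.W` a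
compact smooth `(n+1)`-manifold with boundary) with a collar `κ : ∂W × [0, 1] → W`
(`Literature.Topology.FourManifolds.BoundaryData.Collar`; collars exist for compact `W`,
`BoundaryData.nonempty_collar_of_compactSpace`), the closed model
`Ŵ = Literature.Topology.FourManifolds.ClosedModel n W = W ∪ cone(∂W)` (the one-point
compactification of the interior, `BoundarySignature.lean`; Kervaire–Milnor, *Groups of homotopy
spheres I*, Ann. of Math. 77 (1963), footnote pp. 528–529) has at its cone point `∞` the
**cone neighbourhoods** `N_ε = {∞} ∪ κ(∂W × (0, ε))`, `0 < ε ≤ 1`.  This file PROVES: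

* `NullCobordism.coneNhd c κ ε` is open, contains `∞`, and **contracts onto `∞`** through itself
  by sliding down the collar lines, `κ(x, t) ↦ κ(x, (1 - s) t)` (`NullCobordism.coneContraction`,
  continuity at `∞`: compact subsets of the interior stay a positive collar distance away from
  the boundary); hence `Hⱼ(N_ε, {∞}) = 0` (`isZero_rel_coneNhd_infty`), `N_ε` is contractible
  (`contractibleSpace_coneNhd`) and `Hⱼ(Ŵ, ∞) ≅ Hⱼ(Ŵ, N_ε)` (`isIso_map_infty_coneNhd`);
* the collar neighbourhood `C_ε = κ(∂W × [0, ε))` deformation retracts onto `∂W`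
  (`NullCobordism.collarSlide`), so `Hⱼ(C_ε, ∂W) = 0` and `Hⱼ(W, ∂W) ≅ Hⱼ(W, C_ε)`
  (`isIso_map_boundary_collarNhd`);
* **Hatcher's Prop. 2.22 for the good pair `(W, ∂W)`**: the collapse
  `q : (W, ∂W) → (Ŵ, {∞})` (`Literature.Topology.FourManifolds.boundaryCollapse`) induces
  isomorphisms `Hⱼ(W, ∂W; G) ≅ Hⱼ(Ŵ, {∞}; G)` for all `j` and all coefficients
  (`NullCobordism.isIso_map_boundaryCollapse` for a given collar, `…_succ` in dimension `≥ 2`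
  where collars exist, `NullCobordism.boundaryCollapseIso` the isomorphism): `(W, ∂W) ≅ (W, C_ε)`
  and `(Ŵ, ∞) ≅ (Ŵ, N_ε)` by the two deformations, `(W, C_ε) ≅ (W ∖ ∂W, C_ε ∖ ∂W)` and
  `(Ŵ, N_ε) ≅ (Ŵ ∖ ∞, N_ε ∖ ∞)` by excision (Hatcher Thm. 2.20), and `q` is a homeomorphism of
  pairs `(W ∖ ∂W, C_ε ∖ ∂W) ≅ (Ŵ ∖ ∞, N_ε ∖ ∞)` (`NullCobordism.interiorHomeo`);
* the collapse is an **isomorphism on local homology at interior points**,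
  `Hⱼ(W | x) ≅ Hⱼ(Ŵ | q x)` (`NullCobordism.isIso_localMap_boundaryCollapse`).

These are the inputs for relating Kervaire–Milnor's oriented bounding manifolds
(`Literature.Topology.FourManifolds.IsOrientedBoundary`: a relative class `w ∈ Hₙ₊₁(W, ∂W)` with
`q_* w = j_* [Ŵ]`) to relative fundamental classes in Spanier's sense and to orientations of `Ŵ`.
Everything is proved; no named facts, no new notions beyond the auxiliary sets `coneNhd`,
`collarNhd`, the deformations and two generalities on the exact sequence of a triple
(`isIso_map_id_of_isZero_triple`, `isZero_rel_of_deformation`). The boundary `M = ∂W` is assumed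
nonempty and compact where collars are used (`W : Type`, as for `HomotopySphere` carriers).

## References

* A. Hatcher, *Algebraic Topology*, CUP 2002, Prop. 2.22 and its proof (good pairs, p. 124),
  Thm. 2.20 (excision), §3.3 p. 231 (local homology). [HatcherAT2002]
* M. Kervaire, J. Milnor, *Groups of homotopy spheres I*, Ann. of Math. 77 (1963), §7, footnote
  pp. 528–529 ("adjoin a cone over the boundary"). [KervaireMilnorAnnals1963]
-/

open scoped Manifold ContDiff Topology
open Set Function Filter CategoryTheory Limits
open Literature.AlgebraicTopology.SingularHomology

noncomputable section

namespace Literature.Topology.FourManifolds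

universe v

/-! ### Two generalities on relative homology -/

section General

variable (R : Type v) [CommRing R] (G : Type v) [AddCommGroup G] [Module R G]
variable {X : Type} [TopologicalSpace X]

/-- **If `H₊(A, B) = 0` then `Hₖ(X, B) ≅ Hₖ(X, A)`** for a triple `B ⊆ A ⊆ X` (long exact
sequence of the triple, Hatcher 2002, §2.1, p. 118; in degree `0` the map is onto because
`C(X, B) → C(X, A)` is). [cite: HatcherAT2002, §2.1, p. 118 (exact sequence of a triple)] -/
theorem isIso_map_id_of_isZero_triple {A B : Set X} (h : B ⊆ A)
    (hz : ∀ j, IsZero (relativeSingularHomology R G (↥A) (Subtype.val ⁻¹' B) j)) (k : ℕ) :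
    IsIso (relativeSingularHomology.map R G (ContinuousMap.id X) (mapsTo_id_of_subset h) k) := by
  haveI hmono : Mono (relativeSingularHomology.map R G (ContinuousMap.id X)
      (mapsTo_id_of_subset h) k) :=
    (relativeSingularHomology.triple_exact₂ R G h k).mono_g ((hz k).eq_of_src _ _)
  haveI hepi : Epi (relativeSingularHomology.map R G (ContinuousMap.id X)
      (mapsTo_id_of_subset h) k) := by
    cases k with
    | zero =>
      haveI := (relativeSingularChainComplex.shortExact_triple R G h).epi_g
      exact HomologicalComplex.epi_homologyMap_of_epi_of_not_rel
        (relativeSingularChainComplex.triple R G h).g 0 (by simp)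
    | succ k =>
      exact (relativeSingularHomology.triple_exact₃ R G h k).epi_f ((hz k).eq_of_tgt _ _)
  exact isIso_of_mono_of_epi _

/-- **A strong deformation retraction of `S` onto `A` kills `H₊(S, A)`**: if `H : [0,1] × S → S`
has `H₀ = 𝟙`, `H₁(S) ⊆ A`, `H_t = 𝟙` on `A` and `H_t(A) ⊆ A`, then `Hₖ(S, A) = 0` for all `k`
(`Hₖ(A, A) ≅ Hₖ(S, A)`, Hatcher 2002, Prop. 2.19). [cite: HatcherAT2002, §2.1, Prop. 2.19] -/
theorem isZero_rel_of_deformation {S : Type} [TopologicalSpace S] (A : Set S)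
    (H : C(unitInterval × S, S)) (h0 : ∀ x, H (0, x) = x) (h1 : ∀ x, H (1, x) ∈ A)
    (hfix : ∀ (t : unitInterval), ∀ x ∈ A, H (t, x) = x) (k : ℕ) :
    IsZero (relativeSingularHomology R G S A k) := by
  have hV : ∀ (t : unitInterval), ∀ x ∈ A, H (t, x) ∈ A := fun t x hx => (hfix t x hx).symm ▸ hx
  haveI := relativeSingularHomology.isIso_map_of_deformation R G A H h0 h1 hfix hV k
  exact IsZero.of_iso (relativeSingularHomology.isZero_preimage_self R G A k)
    (asIso (relativeSingularHomology.map R G (subsetIncl A)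
      (relativeSingularHomology.mapsTo_subsetIncl_preimage A A) k)).symm

end General

namespace NullCobordism

variable {n : ℕ} {M : Type} [TopologicalSpace M] [ChartedSpace (EuclideanSpace ℝ (Fin n)) M]
  [IsManifold (𝓡 n) ∞ M] (c : NullCobordism.{0} n M) (κ : c.boundaryData.Collar)

/-! ### Collar neighbourhoods `C_ε = κ(∂W × [0, ε))` and cone neighbourhoods `N_ε` -/

/-- The **collar neighbourhood** `C_ε = κ(∂W × [0, ε)) ⊆ W` of the boundary. Hirsch 1976, §4.6.
[folklore] -/
def collarNhd (ε : ℝ) : Set c.W := κ '' {p | (p.2 : ℝ) < ε}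

/-- Unfolding lemma for `collarNhd`. [folklore] -/
theorem collarNhd_def (ε : ℝ) : c.collarNhd κ ε = κ '' {p | (p.2 : ℝ) < ε} := rfl

/-- `κ p ∈ C_ε ↔ p.2 < ε` (a collar is injective). [folklore] -/
theorem collar_mem_collarNhd_iff {ε : ℝ} (p : M × Set.Icc (0 : ℝ) 1) :
    κ p ∈ c.collarNhd κ ε ↔ (p.2 : ℝ) < ε := by
  constructor
  · rintro ⟨p', hp', h⟩
    rwa [← κ.injective h]
  · exact fun h => ⟨p, h, rfl⟩

/-- The boundary lies in `C_ε` for `ε > 0`. [folklore] -/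
theorem boundary_subset_collarNhd {ε : ℝ} (hε : 0 < ε) :
    (𝓡∂ (n + 1)).boundary c.W ⊆ c.collarNhd κ ε :=
  c.boundary_subset_image_collar κ hε

/-- `C_ε` is open for `ε ≤ 1`. [folklore] -/
theorem isOpen_collarNhd {ε : ℝ} (hε : ε ≤ 1) : IsOpen (c.collarNhd κ ε) :=
  c.isOpen_image_collar κ hε

/-- `C_ε ⊆ range κ`. [folklore] -/
theorem collarNhd_subset_range (ε : ℝ) : c.collarNhd κ ε ⊆ range κ :=
  image_subset_range _ _

/-- The **cone neighbourhood** `N_ε = {∞} ∪ q(κ(∂W × (0, ε)))` of the cone point in the closed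
model `Ŵ = W ∪ cone(∂W)` (for `ε = 1` this is the source of the cone chart,
`NullCobordism.coneChartSource`). Kervaire–Milnor 1963, footnote pp. 528–529.
[cite: KervaireMilnorAnnals1963, §7, footnote pp. 528–529] -/
def coneNhd (ε : ℝ) : Set (ClosedModel n c.W) :=
  insert ClosedModel.infty
    (ClosedModel.ofInterior '' {q : ManifoldInterior n c.W | q.1 ∈ c.collarNhd κ ε})

/-- `∞ ∈ N_ε`. [folklore] -/
theorem infty_mem_coneNhd (ε : ℝ) : ClosedModel.infty ∈ c.coneNhd κ ε := mem_insert _ _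

/-- An interior point lies in `N_ε` iff it lies in `C_ε`. [folklore] -/
theorem ofInterior_mem_coneNhd_iff {ε : ℝ} (q : ManifoldInterior n c.W) :
    ClosedModel.ofInterior q ∈ c.coneNhd κ ε ↔ q.1 ∈ c.collarNhd κ ε := by
  change (q : OnePoint (ManifoldInterior n c.W)) ∈
      insert (OnePoint.infty : OnePoint (ManifoldInterior n c.W))
        (((↑) : ManifoldInterior n c.W → OnePoint (ManifoldInterior n c.W)) ''
          {q : ManifoldInterior n c.W | q.1 ∈ c.collarNhd κ ε}) ↔ _
  rw [mem_insert_iff, OnePoint.coe_injective.mem_set_image]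
  simp only [OnePoint.coe_ne_infty, false_or, mem_setOf_eq]

/-- The trace of `N_ε` on the interior is the trace of `C_ε`. [folklore] -/
theorem preimage_coe_coneNhd (ε : ℝ) :
    ((↑) : ManifoldInterior n c.W → OnePoint (ManifoldInterior n c.W)) ⁻¹' c.coneNhd κ ε =
      {q : ManifoldInterior n c.W | q.1 ∈ c.collarNhd κ ε} := by
  ext q
  exact c.ofInterior_mem_coneNhd_iff κ q

/-- `N_ε` is open in the closed model for `0 < ε ≤ 1` (`M = ∂W` compact): its trace on the
interior is open and has compact complement. [folklore] -/
theorem isOpen_coneNhd [CompactSpace M] {ε : ℝ} (hε : 0 < ε) (hε1 : ε ≤ 1) :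
    IsOpen (c.coneNhd κ ε) := by
  refine (OnePoint.isOpen_iff_of_mem' (c.infty_mem_coneNhd κ ε)).2 ⟨?_, ?_⟩
  · rw [c.preimage_coe_coneNhd κ ε]
    exact c.isCompact_compl_preimage_image_collar κ hε hε1
  · rw [c.preimage_coe_coneNhd κ ε]
    exact (c.isOpen_collarNhd κ hε1).preimage continuous_subtype_val

/-- Monotonicity of the cone neighbourhoods. [folklore] -/
theorem coneNhd_mono {ε ε' : ℝ} (h : ε ≤ ε') : c.coneNhd κ ε ⊆ c.coneNhd κ ε' := by
  rintro y hy
  rcases (mem_insert_iff).1 hy with rfl | ⟨q, hq, rfl⟩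
  · exact c.infty_mem_coneNhd κ ε'
  · refine (c.ofInterior_mem_coneNhd_iff κ q).2 ?_
    obtain ⟨p, hp, hpq⟩ := hq
    exact ⟨p, lt_of_lt_of_le hp h, hpq⟩

/-! ### Sliding down the collar lines -/

/-- The slide `(s, t) ↦ (1 - s) t` of the collar parameter, `[0, 1] × [0, 1] → [0, 1]`.
[folklore] -/
def slide (s : unitInterval) (t : Set.Icc (0 : ℝ) 1) : Set.Icc (0 : ℝ) 1 :=
  ⟨(1 - (s : ℝ)) * t, mul_nonneg (sub_nonneg.2 s.2.2) t.2.1,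
    (mul_le_of_le_one_left t.2.1 (sub_le_self _ s.2.1)).trans t.2.2⟩

/-- `slide s t = (1 - s) t`. [folklore] -/
@[simp] theorem coe_slide (s : unitInterval) (t : Set.Icc (0 : ℝ) 1) : (slide s t : ℝ) = (1 - (s : ℝ)) * t := rfl

/-- The slide is jointly continuous. [folklore] -/
theorem continuous_slide : Continuous fun p : unitInterval × Set.Icc (0 : ℝ) 1 => slide p.1 p.2 :=
  (((continuous_const.sub (continuous_subtype_val.comp continuous_fst)).mul
    (continuous_subtype_val.comp continuous_snd)).subtype_mk _)

/-- At time `0` the slide is the identity. [folklore] -/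
@[simp] theorem slide_zero (t : Set.Icc (0 : ℝ) 1) : slide 0 t = t :=
  Subtype.ext (by simp)

/-- At time `1` everything has slid down to `0`. [folklore] -/
@[simp] theorem slide_one (t : Set.Icc (0 : ℝ) 1) : slide 1 t = ⊥ :=
  Subtype.ext (by simp [Set.Icc.coe_bot])

/-- The bottom does not move. [folklore] -/
@[simp] theorem slide_bot (s : unitInterval) : slide s ⊥ = ⊥ :=
  Subtype.ext (by simp [Set.Icc.coe_bot])

/-- The slide does not increase the collar parameter. [folklore] -/
theorem coe_slide_le (s : unitInterval) (t : Set.Icc (0 : ℝ) 1) : (slide s t : ℝ) ≤ t :=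
  mul_le_of_le_one_left t.2.1 (sub_le_self _ s.2.1)

/-- A collar point in the boundary has collar parameter `0`. [folklore] -/
theorem snd_eq_bot_of_collar_mem_boundary {p : M × Set.Icc (0 : ℝ) 1}
    (hp : κ p ∈ (𝓡∂ (n + 1)).boundary c.W) : p.2 = ⊥ := by
  rcases p with ⟨x, t⟩
  by_contra ht
  have ht' : ⊥ < t := lt_of_le_of_ne bot_le (Ne.symm ht)
  exact (ModelWithCorners.disjoint_interior_boundary (I := 𝓡∂ (n + 1))).le_bot
    ⟨κ.apply_mem_interior x ht', hp⟩

section CollarSlide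

variable [Nonempty M]

/-- `κ (collarInv y) = y` on the range of the collar. [folklore] -/
theorem collar_collarInv {y : c.W} (hy : y ∈ range κ) : κ (c.collarInv κ y) = y := by
  obtain ⟨p, rfl⟩ := hy
  rw [collarInv_apply]

/-- On `C_ε` the collar parameter is `< ε`. [folklore] -/
theorem collarInv_snd_lt {ε : ℝ} {y : c.W} (hy : y ∈ c.collarNhd κ ε) :
    ((c.collarInv κ y).2 : ℝ) < ε := by
  obtain ⟨p, hp, rfl⟩ := hy
  rwa [collarInv_apply]

/-- **The collar slide on `C_ε`**: `(s, κ(x, t)) ↦ κ(x, (1 - s) t)`, a continuous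
deformation of the collar neighbourhood into itself. Hatcher 2002, proof of Prop. 2.22 (good
pairs: `A` is a deformation retract of a neighbourhood). [cite: HatcherAT2002, §2.1, Prop. 2.22 (proof)] -/
def collarSlide (ε : ℝ) :
    C(unitInterval × ↥(c.collarNhd κ ε), ↥(c.collarNhd κ ε)) where
  toFun p := ⟨κ ((c.collarInv κ p.2.1).1, slide p.1 (c.collarInv κ p.2.1).2), by
    refine (c.collar_mem_collarNhd_iff κ _).2 ?_
    exact lt_of_le_of_lt (coe_slide_le _ _) (c.collarInv_snd_lt κ p.2.2)⟩
  continuous_toFun := by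
    have hinv : Continuous fun y : ↥(c.collarNhd κ ε) => c.collarInv κ y.1 :=
      (c.continuousOn_collarInv κ).comp_continuous continuous_subtype_val
        fun y => c.collarNhd_subset_range κ ε y.2
    refine Continuous.subtype_mk (κ.continuous.comp ?_) _
    exact ((continuous_fst.comp hinv).comp continuous_snd).prodMk
      (continuous_slide.comp (continuous_fst.prodMk ((continuous_snd.comp hinv).comp
        continuous_snd)))

/-- Formula for the collar slide. [folklore] -/
theorem collarSlide_apply_coe (ε : ℝ) (s : unitInterval) (y : ↥(c.collarNhd κ ε)) :
    (c.collarSlide κ ε (s, y) : c.W) =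
      κ ((c.collarInv κ y.1).1, slide s (c.collarInv κ y.1).2) := rfl

/-- The collar slide starts at the identity. [folklore] -/
theorem collarSlide_zero (ε : ℝ) (y : ↥(c.collarNhd κ ε)) :
    c.collarSlide κ ε (0, y) = y := by
  apply Subtype.ext
  rw [collarSlide_apply_coe, slide_zero, Prod.mk.eta]
  exact c.collar_collarInv κ (c.collarNhd_subset_range κ ε y.2)

/-- The collar slide ends in the boundary. [folklore] -/
theorem collarSlide_one_mem (ε : ℝ) (y : ↥(c.collarNhd κ ε)) :
    c.collarSlide κ ε (1, y) ∈
      (Subtype.val ⁻¹' (𝓡∂ (n + 1)).boundary c.W : Set ↥(c.collarNhd κ ε)) := by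
  show (c.collarSlide κ ε (1, y) : c.W) ∈ (𝓡∂ (n + 1)).boundary c.W
  rw [collarSlide_apply_coe, slide_one]
  exact κ.apply_bot_mem_boundary _

/-- The collar slide fixes the boundary pointwise. [folklore] -/
theorem collarSlide_of_mem_boundary (ε : ℝ) (s : unitInterval) (y : ↥(c.collarNhd κ ε))
    (hy : (y : c.W) ∈ (𝓡∂ (n + 1)).boundary c.W) : c.collarSlide κ ε (s, y) = y := by
  apply Subtype.ext
  rw [collarSlide_apply_coe]
  have hy' : κ (c.collarInv κ y.1) = y := c.collar_collarInv κ (c.collarNhd_subset_range κ ε y.2)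
  have hbot : (c.collarInv κ y.1).2 = ⊥ :=
    c.snd_eq_bot_of_collar_mem_boundary κ (by rw [hy']; exact hy)
  rw [hbot, slide_bot, ← hbot, Prod.mk.eta, hy']

/-- **`H₊(C_ε, ∂W) = 0`**: the collar neighbourhood deformation retracts onto the boundary
(Hatcher 2002, proof of Prop. 2.22). [cite: HatcherAT2002, §2.1, Prop. 2.22 (proof)] -/
theorem isZero_rel_collarNhd_boundary (R : Type v) [CommRing R] (G : Type v) [AddCommGroup G]
    [Module R G] (ε : ℝ) (k : ℕ) :
    IsZero (relativeSingularHomology R G (↥(c.collarNhd κ ε))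
      (Subtype.val ⁻¹' (𝓡∂ (n + 1)).boundary c.W) k) :=
  isZero_rel_of_deformation R G _ (c.collarSlide κ ε) (c.collarSlide_zero κ ε)
    (c.collarSlide_one_mem κ ε) (fun s y hy => c.collarSlide_of_mem_boundary κ ε s y hy) k

/-- **`Hₖ(W, ∂W) ≅ Hₖ(W, C_ε)`** for `0 < ε` (long exact sequence of the triple
`∂W ⊆ C_ε ⊆ W` and `H₊(C_ε, ∂W) = 0`; Hatcher 2002, proof of Prop. 2.22).
[cite: HatcherAT2002, §2.1, Prop. 2.22 (proof)] -/
theorem isIso_map_boundary_collarNhd (R : Type v) [CommRing R] (G : Type v) [AddCommGroup G]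
    [Module R G] {ε : ℝ} (hε : 0 < ε) (k : ℕ) :
    IsIso (relativeSingularHomology.map R G (ContinuousMap.id c.W)
      (mapsTo_id_of_subset (c.boundary_subset_collarNhd κ hε)) k) :=
  isIso_map_id_of_isZero_triple R G (c.boundary_subset_collarNhd κ hε)
    (fun j => c.isZero_rel_collarNhd_boundary κ R G ε j) k

end CollarSlide

/-! ### Contracting the cone neighbourhoods -/

section ConeContraction

variable [Nonempty M]

/-- The underlying point of `W` of a point of `Ŵ = (W ∖ ∂W) ∪ {∞}` (junk value at `∞`).
[folklore] -/
def basePt (y : ClosedModel n c.W) : c.W :=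
  OnePoint.elim y (c.incl (Classical.arbitrary M)) fun q => q.1

omit [IsManifold (𝓡 n) ∞ M] in
/-- `basePt` of an interior point. [folklore] -/
@[simp] theorem basePt_ofInterior (q : ManifoldInterior n c.W) :
    c.basePt (ClosedModel.ofInterior q) = q.1 := rfl

omit [IsManifold (𝓡 n) ∞ M] in
/-- `basePt` is continuous at every point other than `∞`. [folklore] -/
theorem continuousAt_basePt (q : ManifoldInterior n c.W) :
    ContinuousAt c.basePt (ClosedModel.ofInterior q) :=
  OnePoint.continuousAt_coe.2 continuous_subtype_val.continuousAt

open Classical in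
/-- **The cone push** `(s, y) ↦` "slide `y` down its collar line by the factor `1 - s`", as a
bare function on `[0, 1] × Ŵ`: `∞ ↦ ∞`, `q(κ(x, t)) ↦ q(κ(x, (1 - s) t))` (junk off the collar).
Kervaire–Milnor 1963, footnote pp. 528–529 (the cone over the boundary). [folklore] -/
def conePushFun (p : unitInterval × ClosedModel n c.W) : ClosedModel n c.W :=
  if p.2 = ClosedModel.infty then ClosedModel.infty
  else boundaryCollapse n c.W
    (κ ((c.collarInv κ (c.basePt p.2)).1, slide p.1 (c.collarInv κ (c.basePt p.2)).2))

/-- The cone push fixes `∞`. [folklore] -/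
@[simp] theorem conePushFun_infty (s : unitInterval) :
    c.conePushFun κ (s, ClosedModel.infty) = ClosedModel.infty := by
  simp [conePushFun]

/-- The cone push off `∞` (the defining formula). [folklore] -/
theorem conePushFun_of_ne {p : unitInterval × ClosedModel n c.W} (hp : p.2 ≠ ClosedModel.infty) :
    c.conePushFun κ p = boundaryCollapse n c.W
      (κ ((c.collarInv κ (c.basePt p.2)).1, slide p.1 (c.collarInv κ (c.basePt p.2)).2)) := by
  simp [conePushFun, hp]

/-- The cone push on interior points. [folklore] -/
theorem conePushFun_ofInterior (s : unitInterval) (q : ManifoldInterior n c.W) :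
    c.conePushFun κ (s, ClosedModel.ofInterior q) =
      boundaryCollapse n c.W (κ ((c.collarInv κ q.1).1, slide s (c.collarInv κ q.1).2)) := by
  rw [c.conePushFun_of_ne κ (OnePoint.coe_ne_infty q)]
  rfl

/-- The collar parameter after the push is at most the collar parameter before. [folklore] -/
theorem snd_push_le (s : unitInterval) (w : c.W) :
    ((((c.collarInv κ w).1, slide s (c.collarInv κ w).2) : M × Set.Icc (0 : ℝ) 1).2 : ℝ) ≤
      (c.collarInv κ w).2 :=
  coe_slide_le _ _

/-- The cone push maps `[0,1] × N_ε` into `N_ε`. [folklore] -/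
theorem conePushFun_mem_coneNhd {ε : ℝ} (s : unitInterval) {y : ClosedModel n c.W}
    (hy : y ∈ c.coneNhd κ ε) : c.conePushFun κ (s, y) ∈ c.coneNhd κ ε := by
  rcases (mem_insert_iff).1 hy with rfl | ⟨q, hq, rfl⟩
  · rw [conePushFun_infty]; exact c.infty_mem_coneNhd κ ε
  · rw [conePushFun_ofInterior]
    have hp' : ((((c.collarInv κ q.1).1, slide s (c.collarInv κ q.1).2) :
        M × Set.Icc (0 : ℝ) 1).2 : ℝ) < ε :=
      lt_of_le_of_lt (c.snd_push_le κ s q.1) (c.collarInv_snd_lt κ hq)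
    by_cases hint : κ ((c.collarInv κ q.1).1, slide s (c.collarInv κ q.1).2) ∈
        (𝓡∂ (n + 1)).interior c.W
    · rw [boundaryCollapse_of_mem_interior hint]
      exact (c.ofInterior_mem_coneNhd_iff κ _).2 ((c.collar_mem_collarNhd_iff κ _).2 hp')
    · rw [boundaryCollapse_apply, boundaryCollapseFun_of_not_mem hint]
      exact c.infty_mem_coneNhd κ ε

/-- The two cases of the cone push of an interior point: the cone point, or the interior point
`κ(x, (1 - s) t)`. [folklore] -/
theorem conePushFun_ofInterior_eq_or (s : unitInterval) (q : ManifoldInterior n c.W) :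
    c.conePushFun κ (s, ClosedModel.ofInterior q) = ClosedModel.infty ∨
      ∃ h : κ ((c.collarInv κ q.1).1, slide s (c.collarInv κ q.1).2) ∈ (𝓡∂ (n + 1)).interior c.W,
        c.conePushFun κ (s, ClosedModel.ofInterior q) =
          ClosedModel.ofInterior ⟨κ ((c.collarInv κ q.1).1, slide s (c.collarInv κ q.1).2), h⟩ := by
  rw [conePushFun_ofInterior]
  by_cases hint : κ ((c.collarInv κ q.1).1, slide s (c.collarInv κ q.1).2) ∈
      (𝓡∂ (n + 1)).interior c.W
  · exact Or.inr ⟨hint, boundaryCollapse_of_mem_interior hint⟩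
  · exact Or.inl (by rw [boundaryCollapse_apply, boundaryCollapseFun_of_not_mem hint])

/-- **The cone push is continuous at the interior points of the collar.** [folklore] -/
theorem continuousAt_conePushFun_of_mem (s : unitInterval) {q : ManifoldInterior n c.W}
    (hq : q.1 ∈ c.collarNhd κ 1) :
    ContinuousAt (c.conePushFun κ) (s, ClosedModel.ofInterior q) := by
  -- off `∞` the push is the composite formula
  have hopen : IsOpen {p : unitInterval × ClosedModel n c.W | p.2 ≠ ClosedModel.infty} :=
    (OnePoint.isClosed_infty.isOpen_compl).preimage continuous_snd
  have hev : c.conePushFun κ =ᶠ[𝓝 (s, ClosedModel.ofInterior q)] fun p =>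
      boundaryCollapse n c.W
        (κ ((c.collarInv κ (c.basePt p.2)).1, slide p.1 (c.collarInv κ (c.basePt p.2)).2)) :=
    Filter.eventuallyEq_of_mem (hopen.mem_nhds (OnePoint.coe_ne_infty q))
      fun p hp => c.conePushFun_of_ne κ hp
  refine (ContinuousAt.congr ?_ hev.symm)
  have hb : ContinuousAt (fun p : unitInterval × ClosedModel n c.W => c.basePt p.2)
      (s, ClosedModel.ofInterior q) :=
    ContinuousAt.comp (f := Prod.snd) (x := (s, ClosedModel.ofInterior q))
      (c.continuousAt_basePt q) continuous_snd.continuousAt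
  have hci : ContinuousAt (c.collarInv κ) (c.basePt (ClosedModel.ofInterior q)) := by
    rw [basePt_ofInterior]
    exact (c.continuousOn_collarInv κ).continuousAt
      (mem_of_superset ((c.isOpen_collarNhd κ le_rfl).mem_nhds hq)
        (c.collarNhd_subset_range κ 1))
  have hinv : ContinuousAt (fun p : unitInterval × ClosedModel n c.W =>
      c.collarInv κ (c.basePt p.2)) (s, ClosedModel.ofInterior q) :=
    ContinuousAt.comp (f := fun p : unitInterval × ClosedModel n c.W => c.basePt p.2)
      (x := (s, ClosedModel.ofInterior q)) hci hb
  refine (boundaryCollapse n c.W).continuous.continuousAt.comp ?_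
  refine κ.continuous.continuousAt.comp ?_
  exact (continuous_fst.continuousAt.comp hinv).prodMk
    (continuous_slide.continuousAt.comp
      (continuous_fst.continuousAt.prodMk (continuous_snd.continuousAt.comp hinv)))

/-- **The cone push is continuous at the cone point** (`M = ∂W` compact): a compact subset of the
interior stays a positive collar distance `δ` away from the boundary, and the push does not
increase collar parameters, so `[0,1] × N_δ` is pushed into the complement. [folklore] -/
theorem continuousAt_conePushFun_infty [CompactSpace M] (s : unitInterval) :
    ContinuousAt (c.conePushFun κ) (s, ClosedModel.infty) := by
  rw [ContinuousAt, conePushFun_infty]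
  refine ((OnePoint.hasBasis_nhds_infty (X := ManifoldInterior n c.W)).tendsto_right_iff).2 ?_
  rintro K ⟨-, hKc⟩
  obtain ⟨δ, hδ, hδK⟩ := c.exists_pos_le_snd_of_isCompact κ hKc
  have hN : univ ×ˢ c.coneNhd κ (min δ 1) ∈ 𝓝 (s, (ClosedModel.infty : ClosedModel n c.W)) :=
    prod_mem_nhds univ_mem ((c.isOpen_coneNhd κ (lt_min hδ one_pos) (min_le_right _ _)).mem_nhds
      (c.infty_mem_coneNhd κ _))
  filter_upwards [hN] with p hp
  rcases p with ⟨s', y⟩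
  obtain ⟨-, hy⟩ := hp
  rcases (mem_insert_iff).1 hy with hy' | ⟨q, hq, hqy⟩
  · simp only at hy'
    rw [hy', conePushFun_infty]
    exact Or.inr rfl
  · simp only at hqy
    rw [← hqy]
    have hlt : ((((c.collarInv κ q.1).1, slide s' (c.collarInv κ q.1).2) :
        M × Set.Icc (0 : ℝ) 1).2 : ℝ) < δ :=
      lt_of_lt_of_le (lt_of_le_of_lt (c.snd_push_le κ s' q.1) (c.collarInv_snd_lt κ hq))
        (min_le_left _ _)
    rcases c.conePushFun_ofInterior_eq_or κ s' q with h | ⟨hint, h⟩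
    · exact h ▸ Or.inr rfl
    · refine h ▸ Or.inl ⟨⟨_, hint⟩, fun hK => ?_, rfl⟩
      exact (not_le.2 hlt) (hδK _ ⟨⟨_, hint⟩, hK, rfl⟩)

/-- **The cone contraction** of `N_ε` (`ε ≤ 1`, `∂W` compact): the cone push as a continuous
map `[0, 1] × N_ε → N_ε`. Kervaire–Milnor 1963, footnote pp. 528–529; Hatcher 2002, proof of
Prop. 2.22. [cite: HatcherAT2002, §2.1, Prop. 2.22 (proof)] -/
def coneContraction [CompactSpace M] {ε : ℝ} (hε1 : ε ≤ 1) :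
    C(unitInterval × ↥(c.coneNhd κ ε), ↥(c.coneNhd κ ε)) where
  toFun p := ⟨c.conePushFun κ (p.1, p.2.1), c.conePushFun_mem_coneNhd κ p.1 p.2.2⟩
  continuous_toFun := by
    refine continuous_iff_continuousAt.2 fun p => ?_
    rw [(Topology.IsInducing.subtypeVal :
      Topology.IsInducing (Subtype.val : ↥(c.coneNhd κ ε) → ClosedModel n c.W)).continuousAt_iff]
    have hg : Continuous fun p : unitInterval × ↥(c.coneNhd κ ε) =>
        ((p.1, p.2.1) : unitInterval × ClosedModel n c.W) :=
      continuous_fst.prodMk (continuous_subtype_val.comp continuous_snd)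
    change ContinuousAt ((c.conePushFun κ) ∘ fun p : unitInterval × ↥(c.coneNhd κ ε) =>
        ((p.1, p.2.1) : unitInterval × ClosedModel n c.W)) p
    refine ContinuousAt.comp ?_ hg.continuousAt
    rcases (mem_insert_iff).1 p.2.2 with h | ⟨q, hq, hqy⟩
    · rw [show ((p.1, p.2.1) : unitInterval × ClosedModel n c.W) = (p.1, ClosedModel.infty) by
        rw [h]]
      exact c.continuousAt_conePushFun_infty κ p.1
    · rw [show ((p.1, p.2.1) : unitInterval × ClosedModel n c.W) =
        (p.1, ClosedModel.ofInterior q) by rw [← hqy]]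
      exact c.continuousAt_conePushFun_of_mem κ p.1
        (image_mono (show {p : M × Set.Icc (0 : ℝ) 1 | (p.2 : ℝ) < ε} ⊆ {p | (p.2 : ℝ) < 1} from
          fun p hp => lt_of_lt_of_le hp hε1) hq)

/-- Formula for the cone contraction. [folklore] -/
theorem coneContraction_apply_coe [CompactSpace M] {ε : ℝ} (hε1 : ε ≤ 1)
    (s : unitInterval) (y : ↥(c.coneNhd κ ε)) :
    (c.coneContraction κ hε1 (s, y) : ClosedModel n c.W) = c.conePushFun κ (s, y.1) := rfl

/-- The cone contraction starts at the identity. [folklore] -/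
theorem coneContraction_zero [CompactSpace M] {ε : ℝ} (hε1 : ε ≤ 1)
    (y : ↥(c.coneNhd κ ε)) : c.coneContraction κ hε1 (0, y) = y := by
  apply Subtype.ext
  rw [coneContraction_apply_coe]
  rcases (mem_insert_iff).1 y.2 with h | ⟨q, hq, hqy⟩
  · rw [h, conePushFun_infty]
  · rw [← hqy]
    rw [conePushFun_ofInterior, slide_zero, Prod.mk.eta,
      c.collar_collarInv κ (c.collarNhd_subset_range κ ε hq), boundaryCollapse_of_mem_interior q.2]
    rfl

/-- The cone contraction ends at the cone point. [folklore] -/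
theorem coneContraction_one [CompactSpace M] {ε : ℝ} (hε1 : ε ≤ 1)
    (y : ↥(c.coneNhd κ ε)) :
    (c.coneContraction κ hε1 (1, y) : ClosedModel n c.W) = ClosedModel.infty := by
  rw [coneContraction_apply_coe]
  rcases (mem_insert_iff).1 y.2 with h | ⟨q, -, hqy⟩
  · rw [h, conePushFun_infty]
  · rw [← hqy]
    rw [conePushFun_ofInterior, slide_one]
    exact boundaryCollapse_of_mem_boundary (κ.apply_bot_mem_boundary _)

/-- The cone contraction fixes the cone point. [folklore] -/
theorem coneContraction_infty [CompactSpace M] {ε : ℝ} (hε1 : ε ≤ 1)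
    (s : unitInterval) (y : ↥(c.coneNhd κ ε)) (hy : (y : ClosedModel n c.W) = ClosedModel.infty) :
    c.coneContraction κ hε1 (s, y) = y := by
  apply Subtype.ext
  rw [coneContraction_apply_coe, hy, conePushFun_infty]

/-- **`H₊(N_ε, {∞}) = 0`**: the cone neighbourhood deformation retracts onto the cone point.
[cite: HatcherAT2002, §2.1, Prop. 2.22 (proof)] -/
theorem isZero_rel_coneNhd_infty [CompactSpace M] (R : Type v) [CommRing R] (G : Type v)
    [AddCommGroup G] [Module R G] {ε : ℝ} (hε1 : ε ≤ 1) (k : ℕ) :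
    IsZero (relativeSingularHomology R G (↥(c.coneNhd κ ε))
      (Subtype.val ⁻¹' {ClosedModel.infty}) k) :=
  isZero_rel_of_deformation R G _ (c.coneContraction κ hε1) (c.coneContraction_zero κ hε1)
    (c.coneContraction_one κ hε1)
    (fun s y hy => c.coneContraction_infty κ hε1 s y hy) k

/-- **The cone neighbourhoods are contractible.** [folklore] -/
theorem contractibleSpace_coneNhd [CompactSpace M] {ε : ℝ} (hε1 : ε ≤ 1) :
    ContractibleSpace ↥(c.coneNhd κ ε) := by
  refine (contractible_iff_id_nullhomotopic _).2 ⟨⟨ClosedModel.infty, c.infty_mem_coneNhd κ ε⟩,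
    ⟨{ toContinuousMap := c.coneContraction κ hε1,
       map_zero_left := c.coneContraction_zero κ hε1,
       map_one_left := fun y => Subtype.ext (c.coneContraction_one κ hε1 y) }⟩⟩

/-- **`Hₖ(Ŵ, {∞}) ≅ Hₖ(Ŵ, N_ε)`** for `ε ≤ 1` (exact sequence of the triple
`{∞} ⊆ N_ε ⊆ Ŵ` and `H₊(N_ε, ∞) = 0`). [cite: HatcherAT2002, §2.1, Prop. 2.22 (proof)] -/
theorem isIso_map_infty_coneNhd [CompactSpace M] (R : Type v) [CommRing R] (G : Type v)
    [AddCommGroup G] [Module R G] {ε : ℝ} (hε1 : ε ≤ 1) (k : ℕ) :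
    IsIso (relativeSingularHomology.map R G (ContinuousMap.id (ClosedModel n c.W))
      (mapsTo_id_of_subset (singleton_subset_iff.2 (c.infty_mem_coneNhd κ ε))) k) :=
  isIso_map_id_of_isZero_triple R G (singleton_subset_iff.2 (c.infty_mem_coneNhd κ ε))
    (fun j => c.isZero_rel_coneNhd_infty κ R G hε1 j) k

end ConeContraction

/-! ### The collapse is a homeomorphism of pairs off the boundary / off the cone point -/

section PairHomeo

/-- **`W ∖ ∂W ≅ Ŵ ∖ {∞}`**: the interior of `W` (as the complement of the boundary) is
homeomorphic to the complement of the cone point, by the collapse map. [folklore] -/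
def interiorHomeo :
    ↥(((𝓡∂ (n + 1)).boundary c.W)ᶜ) ≃ₜ ↥(({ClosedModel.infty}ᶜ : Set (ClosedModel n c.W))) :=
  (Homeomorph.setCongr (ModelWithCorners.compl_boundary (I := 𝓡∂ (n + 1)) (M := c.W))).trans
    ((OnePoint.isOpenEmbedding_coe (X := ManifoldInterior n c.W)).toIsEmbedding.toHomeomorph.trans
      (Homeomorph.setCongr (OnePoint.compl_infty (X := ManifoldInterior n c.W)).symm))

omit [IsManifold (𝓡 n) ∞ M] in
/-- A point off the boundary is an interior point. [folklore] -/
theorem mem_interior_of_mem_compl_boundary {x : c.W} (hx : x ∈ ((𝓡∂ (n + 1)).boundary c.W)ᶜ) :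
    x ∈ (𝓡∂ (n + 1)).interior c.W := by
  rwa [← ModelWithCorners.compl_boundary]

omit [IsManifold (𝓡 n) ∞ M] in
/-- Formula: `interiorHomeo x = q x` is the point `x` of the interior. [folklore] -/
theorem interiorHomeo_apply_coe (x : ↥(((𝓡∂ (n + 1)).boundary c.W)ᶜ)) :
    (c.interiorHomeo x : ClosedModel n c.W) =
      ClosedModel.ofInterior ⟨x.1, c.mem_interior_of_mem_compl_boundary x.2⟩ := rfl

omit [IsManifold (𝓡 n) ∞ M] in
/-- `interiorHomeo x = q x`. [folklore] -/
theorem interiorHomeo_apply_coe' (x : ↥(((𝓡∂ (n + 1)).boundary c.W)ᶜ)) :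
    (c.interiorHomeo x : ClosedModel n c.W) = boundaryCollapse n c.W x.1 := by
  rw [interiorHomeo_apply_coe,
    boundaryCollapse_of_mem_interior (c.mem_interior_of_mem_compl_boundary x.2)]

/-- The collapse as a map of pairs `(W, C_ε) → (Ŵ, N_ε)`. [folklore] -/
theorem mapsTo_boundaryCollapse_collarNhd (ε : ℝ) :
    MapsTo (boundaryCollapse n c.W) (c.collarNhd κ ε) (c.coneNhd κ ε) := by
  intro w hw
  by_cases hint : w ∈ (𝓡∂ (n + 1)).interior c.W
  · rw [boundaryCollapse_of_mem_interior hint]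
    exact (c.ofInterior_mem_coneNhd_iff κ ⟨w, hint⟩).2 hw
  · rw [boundaryCollapse_apply, boundaryCollapseFun_of_not_mem hint]
    exact c.infty_mem_coneNhd κ ε

/-- `interiorHomeo` maps `C_ε ∖ ∂W` into `N_ε ∖ ∞`. [folklore] -/
theorem mapsTo_interiorHomeo (ε : ℝ) :
    MapsTo c.interiorHomeo (Subtype.val ⁻¹' c.collarNhd κ ε) (Subtype.val ⁻¹' c.coneNhd κ ε) := by
  intro x hx
  show (c.interiorHomeo x : ClosedModel n c.W) ∈ c.coneNhd κ ε
  rw [interiorHomeo_apply_coe']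
  exact c.mapsTo_boundaryCollapse_collarNhd κ ε hx

/-- `interiorHomeo⁻¹` maps `N_ε ∖ ∞` into `C_ε ∖ ∂W`. [folklore] -/
theorem mapsTo_interiorHomeo_symm (ε : ℝ) :
    MapsTo c.interiorHomeo.symm (Subtype.val ⁻¹' c.coneNhd κ ε)
      (Subtype.val ⁻¹' c.collarNhd κ ε) := by
  intro y hy
  obtain ⟨x, rfl⟩ := c.interiorHomeo.surjective y
  rw [Homeomorph.symm_apply_apply]
  have hy' : (c.interiorHomeo x : ClosedModel n c.W) ∈ c.coneNhd κ ε := hy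
  rw [interiorHomeo_apply_coe] at hy'
  exact (c.ofInterior_mem_coneNhd_iff κ _).1 hy'

omit [IsManifold (𝓡 n) ∞ M] in
/-- The commutative square: `(↥{∞}ᶜ ↪ Ŵ) ∘ interiorHomeo = q ∘ (↥(∂W)ᶜ ↪ W)`. [folklore] -/
theorem subsetIncl_comp_interiorHomeo :
    (subsetIncl ({ClosedModel.infty}ᶜ : Set (ClosedModel n c.W))).comp
        (c.interiorHomeo : C(↥(((𝓡∂ (n + 1)).boundary c.W)ᶜ), ↥(({ClosedModel.infty}ᶜ : Set (ClosedModel n c.W))))) =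
      (boundaryCollapse n c.W).comp (subsetIncl (((𝓡∂ (n + 1)).boundary c.W)ᶜ)) := by
  ext x
  exact c.interiorHomeo_apply_coe' x

end PairHomeo

/-! ### Hatcher's Prop. 2.22: `Hⱼ(W, ∂W) ≅ Hⱼ(Ŵ, ∞)` -/

section GoodPair

variable [Nonempty M] [CompactSpace M] (R : Type v) [CommRing R] (G : Type v) [AddCommGroup G]
  [Module R G]

omit [Nonempty M] [CompactSpace M] in
/-- **Excision off the boundary**: `Hₖ(W ∖ ∂W, C_ε ∖ ∂W) ≅ Hₖ(W, C_ε)` for `0 < ε ≤ 1`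
(Hatcher 2002, Thm. 2.20: `∂W` is closed and lies in the open `C_ε`). [cite: HatcherAT2002, Thm. 2.20] -/
theorem isIso_map_subsetIncl_compl_boundary {ε : ℝ} (hε : 0 < ε) (hε1 : ε ≤ 1) (k : ℕ) :
    IsIso (relativeSingularHomology.map R G (subsetIncl (((𝓡∂ (n + 1)).boundary c.W)ᶜ))
      (mapsTo_preimage Subtype.val (c.collarNhd κ ε) :
        MapsTo _ (Subtype.val ⁻¹' c.collarNhd κ ε) (c.collarNhd κ ε)) k) := by
  refine relativeSingularHomology.isIso_map_of_closure_subset_interior_holds R G c.W ?_ k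
  have hcl : IsClosed ((𝓡∂ (n + 1)).boundary c.W) :=
    ModelWithCorners.isClosed_boundary (I := 𝓡∂ (n + 1)) (M := c.W) (n := 1) one_ne_zero
  rw [hcl.closure_eq, (c.isOpen_collarNhd κ hε1).interior_eq]
  exact c.boundary_subset_collarNhd κ hε

omit [Nonempty M] in
/-- **Excision off the cone point**: `Hₖ(Ŵ ∖ ∞, N_ε ∖ ∞) ≅ Hₖ(Ŵ, N_ε)` for `0 < ε ≤ 1`
(Hatcher 2002, Thm. 2.20: `{∞}` is closed and lies in the open `N_ε`). [cite: HatcherAT2002, Thm. 2.20] -/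
theorem isIso_map_subsetIncl_compl_infty {ε : ℝ} (hε : 0 < ε) (hε1 : ε ≤ 1) (k : ℕ) :
    IsIso (relativeSingularHomology.map R G
      (subsetIncl ({ClosedModel.infty}ᶜ : Set (ClosedModel n c.W)))
      (mapsTo_preimage Subtype.val (c.coneNhd κ ε) :
        MapsTo _ (Subtype.val ⁻¹' c.coneNhd κ ε) (c.coneNhd κ ε)) k) := by
  refine relativeSingularHomology.isIso_map_of_closure_subset_interior_holds R G
    (ClosedModel n c.W) ?_ k
  have hcl : IsClosed ({ClosedModel.infty} : Set (ClosedModel n c.W)) := OnePoint.isClosed_infty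
  rw [hcl.closure_eq, (c.isOpen_coneNhd κ hε hε1).interior_eq]
  exact singleton_subset_iff.2 (c.infty_mem_coneNhd κ ε)

omit [Nonempty M] in
/-- **The collapse induces `Hₖ(W, C_ε) ≅ Hₖ(Ŵ, N_ε)`** for `0 < ε ≤ 1`: both sides excise to the
homeomorphic pairs `(W ∖ ∂W, C_ε ∖ ∂W) ≅ (Ŵ ∖ ∞, N_ε ∖ ∞)`. [cite: HatcherAT2002, §2.1, Prop. 2.22 (proof)] -/
theorem isIso_map_boundaryCollapse_collarNhd {ε : ℝ} (hε : 0 < ε) (hε1 : ε ≤ 1) (k : ℕ) :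
    IsIso (relativeSingularHomology.map R G (boundaryCollapse n c.W)
      (c.mapsTo_boundaryCollapse_collarNhd κ ε) k) := by
  -- the square `eW ≫ qC = h ≫ eŴ`
  have hsq : relativeSingularHomology.map R G (subsetIncl (((𝓡∂ (n + 1)).boundary c.W)ᶜ))
        (mapsTo_preimage Subtype.val (c.collarNhd κ ε) :
          MapsTo _ (Subtype.val ⁻¹' c.collarNhd κ ε) (c.collarNhd κ ε)) k ≫
      relativeSingularHomology.map R G (boundaryCollapse n c.W)
        (c.mapsTo_boundaryCollapse_collarNhd κ ε) k =
      relativeSingularHomology.map R G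
        (c.interiorHomeo : C(↥(((𝓡∂ (n + 1)).boundary c.W)ᶜ), ↥(({ClosedModel.infty}ᶜ : Set (ClosedModel n c.W)))))
        (c.mapsTo_interiorHomeo κ ε) k ≫
      relativeSingularHomology.map R G
        (subsetIncl ({ClosedModel.infty}ᶜ : Set (ClosedModel n c.W)))
        (mapsTo_preimage Subtype.val (c.coneNhd κ ε) :
          MapsTo _ (Subtype.val ⁻¹' c.coneNhd κ ε) (c.coneNhd κ ε)) k := by
    rw [← relativeSingularHomology.map_comp, ← relativeSingularHomology.map_comp]
    exact relativeSingularHomology.map_congr R G (c.subsetIncl_comp_interiorHomeo).symm _ _ k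
  haveI := c.isIso_map_subsetIncl_compl_boundary κ R G hε hε1 k
  haveI := c.isIso_map_subsetIncl_compl_infty κ R G hε hε1 k
  haveI := relativeSingularHomology.isIso_map_homeomorph R G c.interiorHomeo
    (c.mapsTo_interiorHomeo κ ε) (c.mapsTo_interiorHomeo_symm κ ε) k
  have hfac : relativeSingularHomology.map R G (boundaryCollapse n c.W)
        (c.mapsTo_boundaryCollapse_collarNhd κ ε) k =
      inv (relativeSingularHomology.map R G (subsetIncl (((𝓡∂ (n + 1)).boundary c.W)ᶜ))
        (mapsTo_preimage Subtype.val (c.collarNhd κ ε) :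
          MapsTo _ (Subtype.val ⁻¹' c.collarNhd κ ε) (c.collarNhd κ ε)) k) ≫
      (relativeSingularHomology.map R G
        (c.interiorHomeo : C(↥(((𝓡∂ (n + 1)).boundary c.W)ᶜ), ↥(({ClosedModel.infty}ᶜ : Set (ClosedModel n c.W)))))
        (c.mapsTo_interiorHomeo κ ε) k ≫
      relativeSingularHomology.map R G
        (subsetIncl ({ClosedModel.infty}ᶜ : Set (ClosedModel n c.W)))
        (mapsTo_preimage Subtype.val (c.coneNhd κ ε) :
          MapsTo _ (Subtype.val ⁻¹' c.coneNhd κ ε) (c.coneNhd κ ε)) k) := by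
    rw [← hsq, IsIso.inv_hom_id_assoc]
  rw [hfac]
  infer_instance

include κ in
/-- **Hatcher's Prop. 2.22 for the good pair `(W, ∂W)`: the collapse `q : (W, ∂W) → (Ŵ, ∞)`
induces isomorphisms `Hₖ(W, ∂W; G) ≅ Hₖ(W ∪ cone(∂W), ∞; G)`** for all `k` and all
coefficients (`W` compact with a collared boundary; `Ŵ = W/∂W`, Hatcher 2002, Prop. 2.22:
"for good pairs `(X, A)`, the quotient map induces isomorphisms `Hₙ(X, A) ≅ Hₙ(X/A, A/A)`";
Kervaire–Milnor 1963, footnote pp. 528–529). [cite: HatcherAT2002, §2.1, Prop. 2.22] -/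
theorem isIso_map_boundaryCollapse (k : ℕ) :
    IsIso (relativeSingularHomology.map R G (boundaryCollapse n c.W)
      (mapsTo_boundaryCollapse n c.W) k) := by
  -- `qB ≫ b = a ≫ qC` with `a`, `b`, `qC` isomorphisms (`ε = 1`)
  have hε : (0 : ℝ) < 1 := one_pos
  have hcomm : relativeSingularHomology.map R G (boundaryCollapse n c.W)
        (mapsTo_boundaryCollapse n c.W) k ≫
      relativeSingularHomology.map R G (ContinuousMap.id (ClosedModel n c.W))
        (mapsTo_id_of_subset (singleton_subset_iff.2 (c.infty_mem_coneNhd κ 1))) k =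
      relativeSingularHomology.map R G (ContinuousMap.id c.W)
        (mapsTo_id_of_subset (c.boundary_subset_collarNhd κ hε)) k ≫
      relativeSingularHomology.map R G (boundaryCollapse n c.W)
        (c.mapsTo_boundaryCollapse_collarNhd κ 1) k := by
    rw [← relativeSingularHomology.map_comp, ← relativeSingularHomology.map_comp]
    exact relativeSingularHomology.map_congr R G
      ((ContinuousMap.id_comp _).trans (ContinuousMap.comp_id _).symm) _ _ k
  haveI := c.isIso_map_infty_coneNhd κ R G (le_refl (1 : ℝ)) k
  haveI := c.isIso_map_boundary_collarNhd κ R G hε k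
  haveI := c.isIso_map_boundaryCollapse_collarNhd κ R G hε le_rfl k
  have hfac : relativeSingularHomology.map R G (boundaryCollapse n c.W)
        (mapsTo_boundaryCollapse n c.W) k =
      (relativeSingularHomology.map R G (ContinuousMap.id c.W)
        (mapsTo_id_of_subset (c.boundary_subset_collarNhd κ hε)) k ≫
      relativeSingularHomology.map R G (boundaryCollapse n c.W)
        (c.mapsTo_boundaryCollapse_collarNhd κ 1) k) ≫
      inv (relativeSingularHomology.map R G (ContinuousMap.id (ClosedModel n c.W))
        (mapsTo_id_of_subset (singleton_subset_iff.2 (c.infty_mem_coneNhd κ 1))) k) := by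
    rw [← hcomm, Category.assoc, IsIso.hom_inv_id, Category.comp_id]
  rw [hfac]
  infer_instance

include κ in
/-- `Hₖ(W, ∂W; G) ≅ Hₖ(Ŵ, ∞; G)` as an isomorphism (`asIso` of the collapse). [cite: HatcherAT2002, §2.1, Prop. 2.22] -/
def boundaryCollapseIso (k : ℕ) :
    relativeSingularHomology R G c.W ((𝓡∂ (n + 1)).boundary c.W) k ≅
      relativeSingularHomology R G (ClosedModel n c.W) {ClosedModel.infty} k :=
  haveI := c.isIso_map_boundaryCollapse κ R G k
  asIso (relativeSingularHomology.map R G (boundaryCollapse n c.W) (mapsTo_boundaryCollapse n c.W) k)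

include κ in
/-- The isomorphism `boundaryCollapseIso` is the collapse. [folklore] -/
@[simp] theorem boundaryCollapseIso_hom (k : ℕ) :
    (c.boundaryCollapseIso κ R G k).hom =
      relativeSingularHomology.map R G (boundaryCollapse n c.W) (mapsTo_boundaryCollapse n c.W) k :=
  rfl

omit κ in
/-- **Prop. 2.22 for `(W, ∂W)` without a chosen collar**, in dimension `n + 1 ≥ 2` where compact
smooth manifolds with boundary have collars (`BoundaryData.nonempty_collar_of_compactSpace`).
[cite: HatcherAT2002, §2.1, Prop. 2.22] -/
theorem isIso_map_boundaryCollapse_succ {m : ℕ} {M' : Type} [TopologicalSpace M']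
    [ChartedSpace (EuclideanSpace ℝ (Fin (m + 1))) M'] [IsManifold (𝓡 (m + 1)) ∞ M'] [Nonempty M'] [CompactSpace M']
    (c' : NullCobordism.{0} (m + 1) M') (k : ℕ) :
    IsIso (relativeSingularHomology.map R G (boundaryCollapse (m + 1) c'.W)
      (mapsTo_boundaryCollapse (m + 1) c'.W) k) := by
  obtain ⟨κ'⟩ := BoundaryData.nonempty_collar_of_compactSpace m c'.W c'.boundaryData
  exact c'.isIso_map_boundaryCollapse κ' R G k

end GoodPair

/-! ### The collapse on local homology at interior points -/

section LocalAtInterior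

variable (R : Type v) [CommRing R] (G : Type v) [AddCommGroup G] [Module R G]

omit [IsManifold (𝓡 n) ∞ M] in
/-- The collapse is a map of pairs `(W, W ∖ x) → (Ŵ, Ŵ ∖ q x)` for an interior point `x` (it is
injective on the interior and sends the boundary to `∞ ≠ q x`). [folklore] -/
theorem mapsTo_boundaryCollapse_compl_singleton {x : c.W} (hx : x ∈ (𝓡∂ (n + 1)).interior c.W) :
    MapsTo (boundaryCollapse n c.W) ({x}ᶜ : Set c.W)
      ({boundaryCollapse n c.W x}ᶜ : Set (ClosedModel n c.W)) := by
  intro y hy h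
  apply hy
  rw [mem_singleton_iff] at h ⊢
  rw [boundaryCollapse_of_mem_interior hx] at h
  by_cases hyi : y ∈ (𝓡∂ (n + 1)).interior c.W
  · rw [boundaryCollapse_of_mem_interior hyi] at h
    exact congrArg Subtype.val (OnePoint.coe_injective h)
  · rw [boundaryCollapse_apply, boundaryCollapseFun_of_not_mem hyi] at h
    exact (OnePoint.infty_ne_coe _ h).elim

omit [IsManifold (𝓡 n) ∞ M] in
/-- **The collapse is an isomorphism on local homology at interior points**:
`q_* : Hₖ(W | x; G) ≅ Hₖ(Ŵ | q x; G)` for `x ∈ W ∖ ∂W` — both sides excise to the local homology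
of the open interior, on which `q` is the open embedding `W ∖ ∂W ↪ Ŵ` (Hatcher 2002, §3.3,
p. 231: local homology depends only on a neighbourhood). [cite: HatcherAT2002, §3.3 p. 231] -/
theorem isIso_localMap_boundaryCollapse {x : c.W} (hx : x ∈ (𝓡∂ (n + 1)).interior c.W) (k : ℕ) :
    IsIso (relativeSingularHomology.map R G (boundaryCollapse n c.W)
      (c.mapsTo_boundaryCollapse_compl_singleton hx) k) := by
  have hOo : IsOpen ((𝓡∂ (n + 1)).interior c.W) := (𝓡∂ (n + 1)).isOpen_interior (M := c.W) one_ne_zero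
  -- the open embedding `W ∖ ∂W ↪ Ŵ`
  set j : C(↥((𝓡∂ (n + 1)).interior c.W), ClosedModel n c.W) :=
    ⟨ClosedModel.ofInterior, OnePoint.continuous_coe⟩ with hj
  have hjx : j ⟨x, hx⟩ = boundaryCollapse n c.W x := (boundaryCollapse_of_mem_interior hx).symm
  have hje : Topology.IsOpenEmbedding (j : ↥((𝓡∂ (n + 1)).interior c.W) → ClosedModel n c.W) :=
    OnePoint.isOpenEmbedding_coe
  haveI i1 : IsIso (relativeSingularHomology.map R G (subsetIncl ((𝓡∂ (n + 1)).interior c.W))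
      (localHomology.mapsTo_subsetIncl_compl hx) k) :=
    localHomology.isIso_map_subsetIncl_of_isOpen R G hOo hx k
  haveI i2 : IsIso (relativeSingularHomology.map R G j
      (mapsTo_compl_singleton_of_injective hje.injective hjx) k) :=
    localHomology.isIso_map_of_isOpenEmbedding_of_eq R G j hje ⟨x, hx⟩ hjx k
  have hfac : relativeSingularHomology.map R G (subsetIncl ((𝓡∂ (n + 1)).interior c.W))
        (localHomology.mapsTo_subsetIncl_compl hx) k ≫
      relativeSingularHomology.map R G (boundaryCollapse n c.W)
        (c.mapsTo_boundaryCollapse_compl_singleton hx) k =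
      relativeSingularHomology.map R G j
        (mapsTo_compl_singleton_of_injective hje.injective hjx) k := by
    rw [← relativeSingularHomology.map_comp]
    refine relativeSingularHomology.map_congr R G ?_ _ _ k
    ext y
    exact boundaryCollapse_of_mem_interior y.2
  have : relativeSingularHomology.map R G (boundaryCollapse n c.W)
        (c.mapsTo_boundaryCollapse_compl_singleton hx) k =
      inv (relativeSingularHomology.map R G (subsetIncl ((𝓡∂ (n + 1)).interior c.W))
        (localHomology.mapsTo_subsetIncl_compl hx) k) ≫
      relativeSingularHomology.map R G j
        (mapsTo_compl_singleton_of_injective hje.injective hjx) k := by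
    rw [← hfac, ← Category.assoc, IsIso.inv_hom_id, Category.id_comp]
  rw [this]
  infer_instance

end LocalAtInterior

end NullCobordism

end Literature.Topology.FourManifolds
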